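import Summits.AtomisticToContinuum.Crystallization.Theorems.PalmUnimodularRigidityLayeredLawsSelectHcpZeroStressSymmetry
import Mathlib.LinearAlgebra.FiniteDimensional.Lemmas

/-!
# Local congruence ⇒ global congruence, I: the labelled hcp star in integer coordinates
(stub `stub_localCongruence` of line `mtp-prestress-split-ergodic-frame`, crux `LayeredLawsSelectHcp`,
stmt-AtomisticToContinuum-9226; part 1 of 4)

The discrete-Liouville endgame of the rigidity half compares, at every point of an hcp-charted
configuration, the re-rooted star with the relaxed reference star `{hcpSite a h v : v ∈ hcpStarIdx}`.
This file is the finite geometry of that reference star, reduced to INTEGER arithmetic: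

* `siteInt v = (2i + j + L, 3j + L, k)`, `L = k mod 2` the letter of layer `k`, puts every hcp site
  on the lattice `(a/2) ℤ × (a√3/6) ℤ × h ℤ` (`hcpSite_eq_siteVec`), so that
  `dist² = a²/12 · q₁ + h² · q₂` with the integer pair `siteQ = (q₁, q₂)` (`hcpSite_dist_sq`); in the
  ideal stacking `(1, √(2/3))` two sites touch iff `q₁ + 8 q₂ = 12` (`dist_ideal_eq_one_iff`);
* on the twelve labels (`starLab`, an enumeration of `hcpStarIdx`) touching pairs have
  `(q₁,q₂) ∈ {(12,0),(4,1)}` and non-touching pairs are far (`star_pairs`, by `decide`), whence in the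
  window `a ∈ [189/200, 199/200]`, `h ∈ [77/100, 163/200]` touching relaxed struts are `≤ 1` apart
  and non-touching ones `> 28/25` apart (`stub_localCongruenceStarMetric`, a registered sub-goal:
  the bond threshold of the chart separates the relaxed star exactly as the ideal one);
* `siteVec`/`det3`: three lattice vectors with non-zero integer determinant are a basis
  (`linearMap_eq_of_eq_on_siteVec`), and every strut has two touching struts completing it to
  such a triple (`star_common`, by `decide`) — the frame-propagation step of part 4.

All `[folklore]`.
-/

noncomputable section

namespace Summit.AtomisticToContinuum.Crystallization.Theorems.PalmUnimodularRigidity.LayeredLawsSelectHcp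

open MeasureTheory Set
open Literature.MathematicalPhysics.StatisticalMechanics Literature.Geometry.DiscreteGeometry

/-! ## Integer coordinates of the sites -/

/-- The letter of layer `k` of hcp is `k mod 2`. [folklore] -/
theorem haggLabel_alternating_eq_emod (k : ℤ) : haggLabel alternatingHagg k = k % 2 := by
  rw [haggLabel_alternating]
  rcases Int.emod_two_eq_zero_or_one k with h | h
  · rw [if_pos (Int.even_iff.2 h), h]
  · rw [if_neg (Int.not_even_iff.2 h), h]

/-- Integer site coordinates `ι(k,i,j) = (2i + j + L, 3j + L, k)`, `L = k mod 2`. [folklore] -/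
def siteInt (v : ℤ × ℤ × ℤ) : ℤ × ℤ × ℤ :=
  (2 * v.2.1 + v.2.2 + v.1 % 2, 3 * v.2.2 + v.1 % 2, v.1)

/-- The integer metric pair `(q₁, q₂) = (3 Δι₁² + Δι₂², Δι₃²)` of two sites. [folklore] -/
def siteQ (v w : ℤ × ℤ × ℤ) : ℤ × ℤ :=
  (3 * ((siteInt v).1 - (siteInt w).1) ^ 2 + ((siteInt v).2.1 - (siteInt w).2.1) ^ 2,
    ((siteInt v).2.2 - (siteInt w).2.2) ^ 2)

/-- The point of `ℝ³` with lattice coordinates `n`: `(a/2 · n₁, a√3/6 · n₂, h · n₃)`. [folklore] -/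
def siteVec (a h : ℝ) (n : ℤ × ℤ × ℤ) : EuclideanSpace ℝ (Fin 3) :=
  !₂[a / 2 * n.1, a * √3 / 6 * n.2.1, h * n.2.2]

/-- Coordinates of `siteVec`. [folklore] -/
theorem siteVec_apply (a h : ℝ) (n : ℤ × ℤ × ℤ) :
    siteVec a h n 0 = a / 2 * n.1 ∧ siteVec a h n 1 = a * √3 / 6 * n.2.1 ∧
      siteVec a h n 2 = h * n.2.2 := by
  simp [siteVec]

/-- **Every hcp site is a lattice point**: `hcpSite a h v = siteVec a h (siteInt v)`. [folklore] -/
theorem hcpSite_eq_siteVec (a h : ℝ) (v : ℤ × ℤ × ℤ) : hcpSite a h v = siteVec a h (siteInt v) := by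
  obtain ⟨e0, e1, e2⟩ := siteVec_apply a h (siteInt v)
  ext l
  fin_cases l
  · simp only [Fin.zero_eta, hcpSite_apply_zero, haggLabel_alternating_eq_emod, e0]
    simp only [siteInt]
    push_cast; ring
  · simp only [Fin.mk_one, hcpSite_apply_one, haggLabel_alternating_eq_emod, e1]
    simp only [siteInt]
    push_cast; ring
  · simp only [Fin.reduceFinMk, hcpSite_apply_two, e2]
    simp only [siteInt]
    ring

/-- `siteVec` is additive: differences. [folklore] -/
theorem siteVec_sub (a h : ℝ) (n n' : ℤ × ℤ × ℤ) :
    siteVec a h n - siteVec a h n' = siteVec a h (n - n') := by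
  ext l; fin_cases l <;> simp [siteVec] <;> ring

/-- `siteVec` is additive: negation. [folklore] -/
theorem siteVec_neg (a h : ℝ) (n : ℤ × ℤ × ℤ) : -siteVec a h n = siteVec a h (-n) := by
  ext l; fin_cases l <;> simp [siteVec]

/-- **Squared distance of two hcp sites in integer form**: `dist² = a²/12 · q₁ + h² · q₂`. [folklore] -/
theorem hcpSite_dist_sq (a h : ℝ) (v w : ℤ × ℤ × ℤ) :
    dist (hcpSite a h v) (hcpSite a h w) ^ 2 =
      a ^ 2 / 12 * (siteQ v w).1 + h ^ 2 * (siteQ v w).2 := by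
  obtain ⟨v0, v1, v2⟩ := siteVec_apply a h (siteInt v)
  obtain ⟨w0, w1, w2⟩ := siteVec_apply a h (siteInt w)
  have h3 : (√3 : ℝ) ^ 2 = 3 := Real.sq_sqrt (by norm_num)
  rw [hcpSite_eq_siteVec, hcpSite_eq_siteVec, EuclideanSpace.dist_sq_eq, Fin.sum_univ_three,
    Real.dist_eq, Real.dist_eq, Real.dist_eq, sq_abs, sq_abs, sq_abs, v0, v1, v2, w0, w1, w2]
  simp only [siteQ]
  push_cast
  linear_combination (a ^ 2 / 36 * (((siteInt v).2.1 : ℝ) - (siteInt w).2.1) ^ 2) * h3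

/-- The integer metric pair is non-negative. [folklore] -/
theorem siteQ_nonneg (v w : ℤ × ℤ × ℤ) : 0 ≤ (siteQ v w).1 ∧ 0 ≤ (siteQ v w).2 :=
  ⟨by unfold siteQ; positivity, by unfold siteQ; positivity⟩

/-- **Touching in the ideal stacking** `(a, h) = (1, √(2/3))` is the integer condition
`q₁ + 8 q₂ = 12`. [folklore] -/
theorem dist_ideal_eq_one_iff (v w : ℤ × ℤ × ℤ) :
    dist (hcpSite 1 (Real.sqrt (2 / 3)) v) (hcpSite 1 (Real.sqrt (2 / 3)) w) = 1 ↔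
      (siteQ v w).1 + 8 * (siteQ v w).2 = 12 := by
  have h23 : Real.sqrt (2 / 3) ^ 2 = 2 / 3 := Real.sq_sqrt (by norm_num)
  have hsq := hcpSite_dist_sq 1 (Real.sqrt (2 / 3)) v w
  rw [h23, one_pow] at hsq
  constructor
  · intro h1
    rw [h1] at hsq
    have : ((siteQ v w).1 : ℝ) + 8 * (siteQ v w).2 = 12 := by linarith
    exact_mod_cast this
  · intro h
    have h' : ((siteQ v w).1 : ℝ) + 8 * (siteQ v w).2 = 12 := by exact_mod_cast h
    have h2 : dist (hcpSite 1 (Real.sqrt (2 / 3)) v) (hcpSite 1 (Real.sqrt (2 / 3)) w) ^ 2 = 1 := by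
      rw [hsq]; linarith
    rwa [pow_eq_one_iff_of_nonneg dist_nonneg two_ne_zero] at h2

/-! ## The twelve labels -/

/-- The twelve star labels `hcpStarIdx`, enumerated (in an order that keeps the automorphism search
below small: a touching triangle first). [folklore] -/
def starLab : Fin 12 → ℤ × ℤ × ℤ :=
  ![(0, 1, 0), (0, 0, 1), (1, 0, 0), (-1, 0, 0), (0, 1, -1), (1, 0, -1),
    (0, 0, -1), (-1, 0, -1), (1, -1, 0), (0, -1, 0), (0, -1, 1), (-1, -1, 0)]

/-- The enumeration lists `hcpStarIdx`. [folklore] -/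
theorem hcpStarIdx_eq_image : hcpStarIdx = Finset.univ.image starLab := by decide

/-- The enumeration is injective. [folklore] -/
theorem starLab_injective : Function.Injective starLab := by decide

/-- Each enumerated label is a star label. [folklore] -/
theorem starLab_mem (m : Fin 12) : starLab m ∈ hcpStarIdx := by
  rw [hcpStarIdx_eq_image]; exact Finset.mem_image_of_mem _ (Finset.mem_univ m)

/-- Every star label is enumerated. [folklore] -/
theorem exists_starLab_eq {v : ℤ × ℤ × ℤ} (hv : v ∈ hcpStarIdx) : ∃ m, starLab m = v := by
  rw [hcpStarIdx_eq_image, Finset.mem_image] at hv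
  obtain ⟨m, -, hm⟩ := hv
  exact ⟨m, hm⟩

/-- Statements over `hcpStarIdx` reduce to statements over the enumeration. [folklore] -/
theorem forall_hcpStarIdx_iff {p : ℤ × ℤ × ℤ → Prop} : (∀ v ∈ hcpStarIdx, p v) ↔ ∀ m, p (starLab m) :=
  ⟨fun h m => h _ (starLab_mem m), fun h v hv => by obtain ⟨m, rfl⟩ := exists_starLab_eq hv; exact h m⟩

/-- **The integer metric of the star** (by `decide`): distinct labels either touch, with
`(q₁,q₂) ∈ {(12,0), (4,1)}`, or are far: `q₂ ≥ 4`, or `q₂ ≥ 1 ∧ q₁ ≥ 16`, or `q₁ ≥ 24`; and every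
label touches the root. [folklore] -/
theorem star_pairs : (∀ m n : Fin 12, m ≠ n →
    ((siteQ (starLab m) (starLab n)).1 + 8 * (siteQ (starLab m) (starLab n)).2 = 12 ∧
      (siteQ (starLab m) (starLab n) = (12, 0) ∨ siteQ (starLab m) (starLab n) = (4, 1))) ∨
    ((siteQ (starLab m) (starLab n)).1 + 8 * (siteQ (starLab m) (starLab n)).2 ≠ 12 ∧
      (4 ≤ (siteQ (starLab m) (starLab n)).2 ∨
        (1 ≤ (siteQ (starLab m) (starLab n)).2 ∧ 16 ≤ (siteQ (starLab m) (starLab n)).1) ∨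
        24 ≤ (siteQ (starLab m) (starLab n)).1))) ∧
    ∀ m : Fin 12, siteQ (starLab m) 0 = (12, 0) ∨ siteQ (starLab m) 0 = (4, 1) := by
  decide

section Window

variable {a h : ℝ} (ha₁ : 189 / 200 ≤ a) (ha₂ : a ≤ 199 / 200) (hh₁ : 77 / 100 ≤ h) (hh₂ : h ≤ 163 / 200)
include ha₁ ha₂ hh₁ hh₂

/-- In the window, a pair with `(q₁,q₂) ∈ {(12,0),(4,1)}` is at distance in `(0, 1]`. [folklore] -/
theorem dist_le_one_of_siteQ {v w : ℤ × ℤ × ℤ} (hq : siteQ v w = (12, 0) ∨ siteQ v w = (4, 1)) :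
    0 < dist (hcpSite a h v) (hcpSite a h w) ∧ dist (hcpSite a h v) (hcpSite a h w) ≤ 1 := by
  have hsq := hcpSite_dist_sq a h v w
  have hd : 0 ≤ dist (hcpSite a h v) (hcpSite a h w) := dist_nonneg
  have h1 : 0 < dist (hcpSite a h v) (hcpSite a h w) ^ 2 ∧ dist (hcpSite a h v) (hcpSite a h w) ^ 2 ≤ 1 := by
    rcases hq with hq | hq <;> rw [hq] at hsq <;> push_cast at hsq <;> constructor <;> nlinarith
  constructor
  · by_contra h0
    have : dist (hcpSite a h v) (hcpSite a h w) = 0 := le_antisymm (not_lt.1 h0) hd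
    rw [this] at h1; norm_num at h1
  · nlinarith [h1.2]

/-- **Touching struts of the relaxed star are `≤ 1` apart** (and distinct). [folklore] -/
theorem star_dist_le_one {v w : ℤ × ℤ × ℤ} (hv : v ∈ hcpStarIdx) (hw : w ∈ hcpStarIdx)
    (hvw : dist (hcpSite 1 (Real.sqrt (2 / 3)) v) (hcpSite 1 (Real.sqrt (2 / 3)) w) = 1) :
    0 < dist (hcpSite a h v) (hcpSite a h w) ∧ dist (hcpSite a h v) (hcpSite a h w) ≤ 1 := by
  obtain ⟨m, rfl⟩ := exists_starLab_eq hv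
  obtain ⟨n, rfl⟩ := exists_starLab_eq hw
  have hmn : m ≠ n := by rintro rfl; simp at hvw
  rw [dist_ideal_eq_one_iff] at hvw
  rcases star_pairs.1 m n hmn with ⟨-, hq⟩ | ⟨hne, -⟩
  · exact dist_le_one_of_siteQ ha₁ ha₂ hh₁ hh₂ hq
  · exact absurd hvw hne

/-- **Struts of the relaxed star are `≤ 1` long** (and non-zero). [folklore] -/
theorem star_norm_le_one {v : ℤ × ℤ × ℤ} (hv : v ∈ hcpStarIdx) :
    0 < ‖hcpSite a h v‖ ∧ ‖hcpSite a h v‖ ≤ 1 := by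
  obtain ⟨m, rfl⟩ := exists_starLab_eq hv
  have := dist_le_one_of_siteQ ha₁ ha₂ hh₁ hh₂ (star_pairs.2 m)
  rwa [hcpSite_zero, dist_zero_right] at this

omit ha₂ hh₂ in
/-- **Non-touching struts of the relaxed star are `> 28/25` apart.** [folklore] -/
theorem star_dist_gt {v w : ℤ × ℤ × ℤ} (hv : v ∈ hcpStarIdx) (hw : w ∈ hcpStarIdx) (hne : v ≠ w)
    (hvw : dist (hcpSite 1 (Real.sqrt (2 / 3)) v) (hcpSite 1 (Real.sqrt (2 / 3)) w) ≠ 1) :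
    28 / 25 < dist (hcpSite a h v) (hcpSite a h w) := by
  obtain ⟨m, rfl⟩ := exists_starLab_eq hv
  obtain ⟨n, rfl⟩ := exists_starLab_eq hw
  have hmn : m ≠ n := fun h => hne (by rw [h])
  rw [Ne, dist_ideal_eq_one_iff] at hvw
  have hsq := hcpSite_dist_sq a h (starLab m) (starLab n)
  obtain ⟨hq1, hq2⟩ := siteQ_nonneg (starLab m) (starLab n)
  have hq1' : (0 : ℝ) ≤ (siteQ (starLab m) (starLab n)).1 := by exact_mod_cast hq1
  have hq2' : (0 : ℝ) ≤ (siteQ (starLab m) (starLab n)).2 := by exact_mod_cast hq2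
  rcases star_pairs.1 m n hmn with ⟨hq, -⟩ | ⟨-, hfar⟩
  · exact absurd hq hvw
  · have hlow : (28 / 25 : ℝ) ^ 2 < dist (hcpSite a h (starLab m)) (hcpSite a h (starLab n)) ^ 2 := by
      rcases hfar with h4 | ⟨h1, h16⟩ | h24
      · have h4' : (4 : ℝ) ≤ (siteQ (starLab m) (starLab n)).2 := by exact_mod_cast h4
        rw [hsq]; nlinarith
      · have h1' : (1 : ℝ) ≤ (siteQ (starLab m) (starLab n)).2 := by exact_mod_cast h1
        have h16' : (16 : ℝ) ≤ (siteQ (starLab m) (starLab n)).1 := by exact_mod_cast h16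
        rw [hsq]; nlinarith
      · have h24' : (24 : ℝ) ≤ (siteQ (starLab m) (starLab n)).1 := by exact_mod_cast h24
        rw [hsq]; nlinarith
    exact lt_of_pow_lt_pow_left₀ 2 dist_nonneg hlow

end Window

/-! ## Three struts with non-zero integer determinant are a basis -/

/-- The `3 × 3` integer determinant of three lattice coordinate vectors. [folklore] -/
def det3 (n₁ n₂ n₃ : ℤ × ℤ × ℤ) : ℤ :=
  n₁.1 * (n₂.2.1 * n₃.2.2 - n₂.2.2 * n₃.2.1) - n₁.2.1 * (n₂.1 * n₃.2.2 - n₂.2.2 * n₃.1) +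
    n₁.2.2 * (n₂.1 * n₃.2.1 - n₂.2.1 * n₃.1)

/-- **Lattice points with non-zero determinant are linearly independent** (`a, h ≠ 0`). [folklore] -/
theorem linearIndependent_siteVec {a h : ℝ} (ha : a ≠ 0) (hh : h ≠ 0) {n₁ n₂ n₃ : ℤ × ℤ × ℤ}
    (hdet : det3 n₁ n₂ n₃ ≠ 0) :
    LinearIndependent ℝ ![siteVec a h n₁, siteVec a h n₂, siteVec a h n₃] := by
  rw [Fintype.linearIndependent_iff]
  intro g hg
  have e0 := congrArg (fun x : EuclideanSpace ℝ (Fin 3) => x 0) hg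
  have e1 := congrArg (fun x : EuclideanSpace ℝ (Fin 3) => x 1) hg
  have e2 := congrArg (fun x : EuclideanSpace ℝ (Fin 3) => x 2) hg
  simp only [Fin.sum_univ_three, Matrix.cons_val_zero, Matrix.cons_val_one, Matrix.cons_val_two,
    Matrix.tail_cons, Matrix.head_cons, PiLp.add_apply, PiLp.smul_apply, PiLp.zero_apply,
    siteVec, smul_eq_mul] at e0 e1 e2
  have h3 : (√3 : ℝ) ≠ 0 := by positivity
  have f0 : g 0 * n₁.1 + g 1 * n₂.1 + g 2 * n₃.1 = 0 := by
    have : a / 2 * (g 0 * n₁.1 + g 1 * n₂.1 + g 2 * n₃.1) = 0 := by linear_combination e0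
    simpa [ha] using this
  have f1 : g 0 * n₁.2.1 + g 1 * n₂.2.1 + g 2 * n₃.2.1 = 0 := by
    have : a * √3 / 6 * (g 0 * n₁.2.1 + g 1 * n₂.2.1 + g 2 * n₃.2.1) = 0 := by linear_combination e1
    simpa [ha, h3] using this
  have f2 : g 0 * n₁.2.2 + g 1 * n₂.2.2 + g 2 * n₃.2.2 = 0 := by
    have : h * (g 0 * n₁.2.2 + g 1 * n₂.2.2 + g 2 * n₃.2.2) = 0 := by linear_combination e2
    simpa [hh] using this
  have hd : (det3 n₁ n₂ n₃ : ℝ) ≠ 0 := by exact_mod_cast hdet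
  have hdR : (det3 n₁ n₂ n₃ : ℝ) = n₁.1 * (n₂.2.1 * n₃.2.2 - n₂.2.2 * n₃.2.1) -
      n₁.2.1 * (n₂.1 * n₃.2.2 - n₂.2.2 * n₃.1) + n₁.2.2 * (n₂.1 * n₃.2.1 - n₂.2.1 * n₃.1) := by
    simp [det3]
  have g0 : g 0 * det3 n₁ n₂ n₃ = 0 := by
    rw [hdR]
    linear_combination ((n₂.2.1 : ℝ) * n₃.2.2 - n₃.2.1 * n₂.2.2) * f0 -
      ((n₂.1 : ℝ) * n₃.2.2 - n₃.1 * n₂.2.2) * f1 + ((n₂.1 : ℝ) * n₃.2.1 - n₃.1 * n₂.2.1) * f2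
  have g1 : g 1 * det3 n₁ n₂ n₃ = 0 := by
    rw [hdR]
    linear_combination -((n₁.2.1 : ℝ) * n₃.2.2 - n₃.2.1 * n₁.2.2) * f0 +
      ((n₁.1 : ℝ) * n₃.2.2 - n₃.1 * n₁.2.2) * f1 - ((n₁.1 : ℝ) * n₃.2.1 - n₃.1 * n₁.2.1) * f2
  have g2 : g 2 * det3 n₁ n₂ n₃ = 0 := by
    rw [hdR]
    linear_combination ((n₁.2.1 : ℝ) * n₂.2.2 - n₂.2.1 * n₁.2.2) * f0 -
      ((n₁.1 : ℝ) * n₂.2.2 - n₂.1 * n₁.2.2) * f1 + ((n₁.1 : ℝ) * n₂.2.1 - n₂.1 * n₁.2.1) * f2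
  intro i
  fin_cases i
  · simpa [hd] using g0
  · simpa [hd] using g1
  · simpa [hd] using g2

/-- **Linear maps agreeing on three lattice points of non-zero determinant are equal.** [folklore] -/
theorem linearMap_eq_of_eq_on_siteVec {a h : ℝ} (ha : a ≠ 0) (hh : h ≠ 0) {n₁ n₂ n₃ : ℤ × ℤ × ℤ}
    (hdet : det3 n₁ n₂ n₃ ≠ 0) {f g : EuclideanSpace ℝ (Fin 3) →ₗ[ℝ] EuclideanSpace ℝ (Fin 3)}
    (h₁ : f (siteVec a h n₁) = g (siteVec a h n₁)) (h₂ : f (siteVec a h n₂) = g (siteVec a h n₂))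
    (h₃ : f (siteVec a h n₃) = g (siteVec a h n₃)) : f = g := by
  let b : Module.Basis (Fin 3) ℝ (EuclideanSpace ℝ (Fin 3)) :=
    basisOfLinearIndependentOfCardEqFinrank (linearIndependent_siteVec ha hh hdet) (by simp)
  refine b.ext fun i => ?_
  fin_cases i <;> simp [b, coe_basisOfLinearIndependentOfCardEqFinrank, h₁, h₂, h₃]

/-- The three labelled struts `(0,1,0), (0,0,1), (1,0,0)` are linearly independent (`a, h ≠ 0`).
[folklore] -/
theorem linearIndependent_three_struts {a h : ℝ} (ha : a ≠ 0) (hh : h ≠ 0) :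
    LinearIndependent ℝ ![hcpSite a h (0, 1, 0), hcpSite a h (0, 0, 1), hcpSite a h (1, 0, 0)] := by
  rw [hcpSite_eq_siteVec, hcpSite_eq_siteVec, hcpSite_eq_siteVec]
  exact linearIndependent_siteVec ha hh (by decide)

/-- **Common neighbours** (by `decide`): every strut label `ε` has two labels `γ₁, γ₂` touching it
such that `−ι ε, ι γ₁ − ι ε, ι γ₂ − ι ε` have non-zero determinant. [folklore] -/
theorem star_common_int : ∀ m : Fin 12, ∃ n₁ n₂ : Fin 12,
    (siteQ (starLab n₁) (starLab m)).1 + 8 * (siteQ (starLab n₁) (starLab m)).2 = 12 ∧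
    (siteQ (starLab n₂) (starLab m)).1 + 8 * (siteQ (starLab n₂) (starLab m)).2 = 12 ∧
    det3 (-siteInt (starLab m)) (siteInt (starLab n₁) - siteInt (starLab m))
      (siteInt (starLab n₂) - siteInt (starLab m)) ≠ 0 := by
  decide

/-- **Common neighbours**, metric form: for every strut `ε` of the star there are struts `γ₁, γ₂`
touching `ε` in the ideal star with `det3 (−ι ε) (ι γ₁ − ι ε) (ι γ₂ − ι ε) ≠ 0`. [folklore] -/
theorem star_common {ε : ℤ × ℤ × ℤ} (hε : ε ∈ hcpStarIdx) : ∃ γ₁ ∈ hcpStarIdx, ∃ γ₂ ∈ hcpStarIdx,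
    dist (hcpSite 1 (Real.sqrt (2 / 3)) γ₁) (hcpSite 1 (Real.sqrt (2 / 3)) ε) = 1 ∧
    dist (hcpSite 1 (Real.sqrt (2 / 3)) γ₂) (hcpSite 1 (Real.sqrt (2 / 3)) ε) = 1 ∧
    det3 (-siteInt ε) (siteInt γ₁ - siteInt ε) (siteInt γ₂ - siteInt ε) ≠ 0 := by
  obtain ⟨m, rfl⟩ := exists_starLab_eq hε
  obtain ⟨n₁, n₂, h₁, h₂, hd⟩ := star_common_int m
  exact ⟨starLab n₁, starLab_mem n₁, starLab n₂, starLab_mem n₂, (dist_ideal_eq_one_iff _ _).2 h₁,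
    (dist_ideal_eq_one_iff _ _).2 h₂, hd⟩

/-- **Registered sub-goal `stub_localCongruenceStarMetric`: the bond threshold separates the relaxed
star exactly as the ideal one.** In the window `a ∈ [189/200, 199/200]`, `h ∈ [77/100, 163/200]`, two
distinct struts `hcpSite a h v`, `hcpSite a h w` (`v, w ∈ hcpStarIdx`) are at distance in `(0, 1]` if
the corresponding ideal struts touch (`dist = 1` at `(1, √(2/3))`) and at distance `> 28/25`
otherwise. [folklore] -/
theorem stub_localCongruenceStarMetric : ∀ a h : ℝ, 189 / 200 ≤ a → a ≤ 199 / 200 → 77 / 100 ≤ h → h ≤ 163 / 200 → ∀ v ∈ hcpStarIdx, ∀ w ∈ hcpStarIdx, v ≠ w → (dist (hcpSite 1 (Real.sqrt (2 / 3)) v) (hcpSite 1 (Real.sqrt (2 / 3)) w) = 1 → 0 < dist (hcpSite a h v) (hcpSite a h w) ∧ dist (hcpSite a h v) (hcpSite a h w) ≤ 1) ∧ (dist (hcpSite 1 (Real.sqrt (2 / 3)) v) (hcpSite 1 (Real.sqrt (2 / 3)) w) ≠ 1 → 28 / 25 < dist (hcpSite a h v) (hcpSite a h w)) :=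
  fun _ _ ha₁ ha₂ hh₁ hh₂ _ hv _ hw hne =>
    ⟨star_dist_le_one ha₁ ha₂ hh₁ hh₂ hv hw, star_dist_gt ha₁ hh₁ hv hw hne⟩

end Summit.AtomisticToContinuum.Crystallization.Theorems.PalmUnimodularRigidity.LayeredLawsSelectHcp

end
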